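import Summits.KontsevichZagierPeriods.KontsevichZagierPeriods.Theorems.BetaCancellation.Negative.PiLink
import Summits.KontsevichZagierPeriods.KontsevichZagierPeriods.Theorems.CompiledSubstitutionsPiNormalisation
import Literature.NumberTheory.Transcendental.KZRelationsLE
import Literature.NumberTheory.Transcendental.KZLogCalculusProofs

/-!
# The half-`π` link of the Legendre sector chain (engine client III, stub S3)

Line cusp-transport of the crux `CompleteModGammaSector` (stmt-KontsevichZagierPeriods-14233),
third client of the certificate-transport engine (the `LegendreSector` chain): its last link,
stub `stub_halfPiLink`. Inside the Kontsevich–Zagier calculus,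
`[(0,1), ½ t^{-1/2} (1-t)^{-1/2}] ∼ [ℝ, 1/(2(1+x²))]` (both of value `π/2`), for ANY two
representations with these domains and integrands agreeing with the displayed ones on them.

Proof: `[β(1/2,1/2)] ∼ [π]` (`equivalent_betaHalfRep_piRep`, four moves, file
`Theorems/BetaCancellation/Negative/PiLink.lean`); `[ℝ, 1/(1+x²)] ∼ [π]`
(`piNormalisation_proof`, first conjunct, at `p := KZ.piRep`) applied to the full Cauchy
representation `2 · r`; scaling both by the algebraic constant `½` (`KZ.Equivalent.constMul`); and
two same-domain/same-integrand identifications (`KZ.of_sub_of_mem_relations_of_eqOn`).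
-/

noncomputable section
set_option linter.dupNamespace false

namespace Summit.KontsevichZagierPeriods.KontsevichZagierPeriods.CompleteModGammaSectorEngine

open MeasureTheory Set
open Literature.NumberTheory.Transcendental
open Literature.NumberTheory.Transcendental.KZ
open Summit.KontsevichZagierPeriods.KontsevichZagierPeriods.BetaCancellationNegative
  (betaHalfRep betaHalfRep_integrand betaKernel equivalent_betaHalfRep_piRep)
open Summit.KontsevichZagierPeriods.CompiledSubstitutions.PiNormalisation (piNormalisation_proof)

/-- `2` is algebraic over `ℚ`. [folklore] -/
private theorem isAlgebraic_two_halfPiLink : IsAlgebraic ℚ (2 : ℝ) := by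
  simpa using isAlgebraic_algebraMap (R := ℚ) (A := ℝ) 2

/-- `1/2` is algebraic over `ℚ`. [folklore] -/
private theorem isAlgebraic_half_halfPiLink : IsAlgebraic ℚ (1 / 2 : ℝ) := by
  simpa using isAlgebraic_algebraMap (R := ℚ) (A := ℝ) (1 / 2)

/-- The full Cauchy representation is `[π]`: any `[ℝ, 1/(1+x²)]` is equivalent to `KZ.piRep`
(`piNormalisation_proof`, first conjunct, at `p := piRep`, whose domain is the closed unit disc
and whose integrand is `1`). [folklore] -/
private theorem equivalent_piRep_of_cauchy_halfPiLink (r : IntegralRep 1)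
    (hrd : r.domain = Set.univ)
    (hri : Set.EqOn r.integrand (fun x => 1 / (1 + x 0 ^ 2)) r.domain) :
    Equivalent r piRep :=
  (piNormalisation_proof piRep rfl (fun _ _ => rfl)).1 r hrd hri

/-- **The half-`π` link** (stub `stub_halfPiLink`, last link of the `LegendreSector` chain):
`[(0,1), ½ t^{-1/2} (1-t)^{-1/2}] ∼ [ℝ, 1/(2(1+x²))]` in the Kontsevich–Zagier calculus, for any
`D`, `r` with these domains and integrands agreeing with the displayed ones on them. Chain:
`D ∼ ½·[β(1/2,1/2)]` (same domain, same integrand on it), `[β(1/2,1/2)] ∼ [π]`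
(`equivalent_betaHalfRep_piRep`), `[π] ∼ 2·r = [ℝ, 1/(1+x²)]` (`piNormalisation_proof`), both
scaled by `½` (`KZ.Equivalent.constMul`), and `½·(2·r) ∼ r` (same integrand).
[cite: KontsevichZagier2001, §1.1 eq. (1)] -/
theorem stub_halfPiLink :
    ∀ (D r : IntegralRep 1), D.domain = {x | x 0 ∈ Set.Ioo (0 : ℝ) 1} → Set.EqOn D.integrand (fun x : Fin 1 → ℝ => 1 / 2 * ((x 0) ^ (-(1 / 2 : ℝ)) * (1 - x 0) ^ (-(1 / 2 : ℝ)))) D.domain → r.domain = Set.univ → Set.EqOn r.integrand (fun x => 1 / (2 * (1 + x 0 ^ 2))) r.domain → Equivalent D r := by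
  intro D r hDd hDi hrd hri
  -- (1) `D ∼ ½·[β(1/2,1/2)]`: same domain `(0,1)`, same integrand on it
  have e : ((1 / 2 : ℚ) : ℝ) - 1 = -(1 / 2 : ℝ) := by norm_num
  have h1 : Equivalent D (betaHalfRep.constMul (1 / 2) isAlgebraic_half_halfPiLink) := by
    refine of_sub_of_mem_relations_of_eqOn (by rw [hDd]; rfl) fun x hx => ?_
    rw [hDi hx]
    simp only [IntegralRep.integrand_constMul, betaHalfRep_integrand, betaKernel, e]
  -- (2) the full Cauchy representation `2·r = [ℝ, 1/(1+x²)] ∼ [π]`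
  have h2 : Equivalent (r.constMul 2 isAlgebraic_two_halfPiLink) piRep := by
    refine equivalent_piRep_of_cauchy_halfPiLink _ (by simp [hrd]) fun x hx => ?_
    have hx' : x ∈ r.domain := by simpa using hx
    have h0 : (1 + x 0 ^ 2 : ℝ) ≠ 0 := by positivity
    simp only [IntegralRep.integrand_constMul, hri hx']
    rw [one_div, one_div, mul_inv, ← mul_assoc, mul_inv_cancel₀ (two_ne_zero' ℝ), one_mul]
  -- (3) `½·[β(1/2,1/2)] ∼ ½·(2·r)` by scaling `[β(1/2,1/2)] ∼ [π] ∼ 2·r`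
  have h3 : Equivalent (betaHalfRep.constMul (1 / 2) isAlgebraic_half_halfPiLink)
      ((r.constMul 2 isAlgebraic_two_halfPiLink).constMul (1 / 2) isAlgebraic_half_halfPiLink) :=
    (equivalent_betaHalfRep_piRep.trans h2.symm).constMul (1 / 2) isAlgebraic_half_halfPiLink
  -- (4) `½·(2·r) ∼ r`: same domain, same integrand
  have h4 : Equivalent ((r.constMul 2 isAlgebraic_two_halfPiLink).constMul (1 / 2)
      isAlgebraic_half_halfPiLink) r :=
    of_sub_of_mem_relations_of_eqOn (by simp) fun x _ => by
      simp only [IntegralRep.integrand_constMul]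
      ring
  exact h1.trans (h3.trans h4)

end Summit.KontsevichZagierPeriods.KontsevichZagierPeriods.CompleteModGammaSectorEngine

end
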